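import Summits.RiemannHypothesis.RiemannHypothesis.Theorems.PfPersistenceCoefficientRigidityDefectEnergy
import HarnessLib

/-!
# Coefficient rigidity of window positivity, VII: the complete phase diagram of the one-site
family (pub-rhpf cand-7, gen 9; mechanism/rigidity campaign; no RH claims)

Seventh part of `PfPersistenceCoefficientRigidity`.  The one-site family
`W_{λ,x₀} = W + λ(δ_{x₀} + δ_{-x₀})` has two real parameters; parts I, III-b and VI treated
`x₀ > 0`.  This file completes the picture over the whole `(λ, x₀)`-plane, including the
exceptional site `x₀ = 0` (where `δ_{x₀} + δ_{-x₀} = 2δ_0` adds `2λ‖g‖₂²`).  ALL STATEMENTS ARE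
PROVED (no `sorry`, no new axioms, RH only as an explicit hypothesis or inside a `by_cases`);
no sentence is DATA.

* `siteQuadratic_neg_site` — `W_{λ,-x₀} = W_{λ,x₀}` (the family is even in `x₀`).
* `exists_weilQuadratic_re_le_ratio` — **(RH-free)** `∀ ε > 0 ∃ g` test, `‖g‖₂ > 0`,
  `Re W(g ⋆ g̃) ≤ ε‖g‖₂²`: the Weil form has NO spectral gap on the test class (its energy density
  is `0` under RH, `-∞` otherwise).
* `siteQuadratic_nonneg_iff_phase` — **PHASE DIAGRAM (RH-free statement)**: for all real `λ, x₀`,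
  `(∀ g test, 0 ≤ Re W_{λ,x₀}(g ⋆ g̃)) ↔ RiemannHypothesis ∧ (λ = 0 ∨ (x₀ = 0 ∧ 0 ≤ λ))`.
  The positive region is the "T": the line `λ = 0` together with the closed half-line
  `{x₀ = 0, λ ≥ 0}` — conditionally on RH — and is EMPTY if RH fails.  RH is NOT claimed.
* `isGLB_defectEnergySet_site_zero_of_riemannHypothesis` — at `x₀ = 0` the defect energy density
  is `2λ` under RH (versus `-2|λ|` at `x₀ ≠ 0`, part VI, here extended to `x₀ < 0`), and
  `riemannHypothesis_iff_bddBelow_defectEnergySet_all` — `RH ↔` the density is finite, for every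
  `(λ, x₀)`.

References: E. Bombieri, Rend. Lincei (9) 11 (2000) 183–233, Thm. 1 (Weil's criterion);
A. Weil (1952).
-/

set_option linter.dupNamespace false

noncomputable section

open Complex Filter Set MeasureTheory
open scoped Real Topology ComplexConjugate NNReal

namespace Summit.RiemannHypothesis.RiemannHypothesis.Theorems.PfPersistenceCoefficientRigidity

open Literature.NumberTheory.LFunctions
open Literature.NumberTheory.LFunctions.WeilConverse
open Summit.RiemannHypothesis.RiemannHypothesis.Theorems.PfPersistenceDownCone
open Summit.RiemannHypothesis.RiemannHypothesis.Theorems.PfPersistenceBarrier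

/-! ## §35 Symmetry in the site and the exceptional site `x₀ = 0` -/

/-- The family is even in the site: `W_{λ,-x₀}(g ⋆ g̃) = W_{λ,x₀}(g ⋆ g̃)`. [this work] -/
theorem siteQuadratic_neg_site (lam x₀ : ℝ) (g : ℝ → ℂ) :
    siteQuadratic lam (-x₀) g = siteQuadratic lam x₀ g := by
  rw [siteQuadratic_eq, siteQuadratic_eq, neg_neg, add_comm (weilConv g (weilReflect g) (-x₀))]

/-- At the exceptional site: `Re W_{λ,0}(g ⋆ g̃) = Re W(g ⋆ g̃) + 2λ‖g‖₂²`. [this work] -/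
theorem siteQuadratic_site_zero_re (lam : ℝ) (g : ℝ → ℂ) :
    (siteQuadratic lam 0 g).re = (weilQuadratic g).re + 2 * lam * ∫ u, ‖g u‖ ^ 2 := by
  rw [siteQuadratic_re, weilConv_weilReflect_apply_zero, Complex.ofReal_re]

/-- **No spectral gap (RH-free).**  For every `ε > 0` some test function with `‖g‖₂ > 0` has
`Re W(g ⋆ g̃) ≤ ε ‖g‖₂²` (part VI with `λ = 0`). [this work] -/
theorem exists_weilQuadratic_re_le_ratio {ε : ℝ} (hε : 0 < ε) :
    ∃ g : ℝ → ℂ, IsWeilTest g ∧ 0 < ∫ u, ‖g u‖ ^ 2 ∧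
      (weilQuadratic g).re ≤ ε * ∫ u, ‖g u‖ ^ 2 := by
  obtain ⟨g, hg, hm, h⟩ := exists_siteQuadratic_re_le_ratio one_pos 0 hε
  refine ⟨g, hg, hm, ?_⟩
  rwa [siteQuadratic_zero, abs_zero, mul_zero, neg_zero, zero_add] at h

/-- The exceptional site: `W_{λ,0}` is positive on the test class iff `λ ≥ 0` and RH.
[this work] -/
theorem siteQuadratic_site_zero_nonneg_iff (lam : ℝ) :
    (∀ g : ℝ → ℂ, IsWeilTest g → 0 ≤ (siteQuadratic lam 0 g).re) ↔
      0 ≤ lam ∧ RiemannHypothesis := by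
  constructor
  · intro h
    have hRH : RiemannHypothesis := by
      refine (riemannHypothesis_iff_siteQuadratic_bddBelow one_pos 0).2 ⟨-(2 * |lam|), fun g hg ↦ ?_⟩
      have h1 := h g hg
      rw [siteQuadratic_site_zero_re] at h1
      rw [siteQuadratic_zero]
      have h2 : -(2 * |lam|) * ∫ u, ‖g u‖ ^ 2 ≤ -(2 * lam) * ∫ u, ‖g u‖ ^ 2 :=
        mul_le_mul_of_nonneg_right (by linarith [le_abs_self lam])
          (integral_nonneg fun u ↦ by positivity)
      linarith
    refine ⟨?_, hRH⟩
    by_contra hlam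
    push Not at hlam
    obtain ⟨g, hg, hm, hW⟩ := exists_weilQuadratic_re_le_ratio (by linarith : 0 < -lam)
    have h1 := h g hg
    rw [siteQuadratic_site_zero_re] at h1
    nlinarith
  · rintro ⟨hlam, hRH⟩ g hg
    rw [siteQuadratic_site_zero_re]
    have hW : 0 ≤ (weilQuadratic g).re := by
      rw [← siteQuadratic_zero 0 g]
      exact (siteQuadratic_zero_nonneg_iff_riemannHypothesis 0).2 hRH g hg
    have : 0 ≤ 2 * lam * ∫ u, ‖g u‖ ^ 2 :=
      mul_nonneg (by positivity) (integral_nonneg fun u ↦ by positivity)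
    linarith

/-- Sites `x₀ ≠ 0`: `W_{λ,x₀}` is positive on the test class iff `λ = 0` and RH (part III-b for
`x₀ > 0`, evenness for `x₀ < 0`). [this work] -/
theorem siteQuadratic_nonneg_iff_of_ne {x₀ : ℝ} (hx0 : x₀ ≠ 0) (lam : ℝ) :
    (∀ g : ℝ → ℂ, IsWeilTest g → 0 ≤ (siteQuadratic lam x₀ g).re) ↔
      lam = 0 ∧ RiemannHypothesis := by
  rcases hx0.lt_or_gt with h | h
  · rw [← siteQuadratic_nonneg_iff (lam := lam) (neg_pos.2 h)]
    simp only [siteQuadratic_neg_site]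
  · exact siteQuadratic_nonneg_iff h

/-! ## §36 The phase diagram -/

/-- **PHASE DIAGRAM of the one-site family (RH-free statement).**  For all real `λ, x₀`:
`W + λ(δ_{x₀} + δ_{-x₀})` is positive on the test class iff RH holds and
(`λ = 0`, or `x₀ = 0 ∧ λ ≥ 0`).  Conditionally on RH the positive region is the "T"
`{λ = 0} ∪ {x₀ = 0, λ ≥ 0}`; if RH fails it is empty.  RH is NOT claimed. [this work] -/
theorem siteQuadratic_nonneg_iff_phase (lam x₀ : ℝ) :
    (∀ g : ℝ → ℂ, IsWeilTest g → 0 ≤ (siteQuadratic lam x₀ g).re) ↔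
      RiemannHypothesis ∧ (lam = 0 ∨ (x₀ = 0 ∧ 0 ≤ lam)) := by
  by_cases hx0 : x₀ = 0
  · subst hx0
    rw [siteQuadratic_site_zero_nonneg_iff]
    constructor
    · rintro ⟨hlam, hRH⟩
      exact ⟨hRH, Or.inr ⟨rfl, hlam⟩⟩
    · rintro ⟨hRH, h | ⟨-, hlam⟩⟩
      · exact ⟨h.ge, hRH⟩
      · exact ⟨hlam, hRH⟩
  · rw [siteQuadratic_nonneg_iff_of_ne hx0]
    constructor
    · rintro ⟨hlam, hRH⟩
      exact ⟨hRH, Or.inl hlam⟩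
    · rintro ⟨hRH, h | ⟨h, -⟩⟩
      · exact ⟨h, hRH⟩
      · exact absurd h hx0

/-- The positive region is empty off RH and is the "T" under RH — corollary listing.
[this work] -/
theorem siteQuadratic_positiveRegion_eq :
    {p : ℝ × ℝ | ∀ g : ℝ → ℂ, IsWeilTest g → 0 ≤ (siteQuadratic p.1 p.2 g).re} =
      {p : ℝ × ℝ | RiemannHypothesis ∧ (p.1 = 0 ∨ (p.2 = 0 ∧ 0 ≤ p.1))} := by
  ext p
  exact siteQuadratic_nonneg_iff_phase p.1 p.2

/-! ## §37 The density table -/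

/-- **At `x₀ = 0` the defect energy density is `2λ` under RH** (the Weil form has density `0`).
[this work] -/
theorem isGLB_defectEnergySet_site_zero_of_riemannHypothesis (hRH : RiemannHypothesis)
    (lam : ℝ) : IsGLB (defectEnergySet lam 0) (2 * lam) := by
  constructor
  · rintro q ⟨g, hg, hm, rfl⟩
    rw [le_div_iff₀ hm, siteQuadratic_site_zero_re]
    have hW : 0 ≤ (weilQuadratic g).re := by
      rw [← siteQuadratic_zero 0 g]
      exact (siteQuadratic_zero_nonneg_iff_riemannHypothesis 0).2 hRH g hg
    linarith
  · intro b hb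
    by_contra h
    push Not at h
    obtain ⟨g, hg, hm, hW⟩ := exists_weilQuadratic_re_le_ratio (by linarith : 0 < (b - 2 * lam) / 2)
    have h1 := hb ⟨g, hg, hm, rfl⟩
    rw [le_div_iff₀ hm, siteQuadratic_site_zero_re] at h1
    nlinarith

/-- **At `x₀ ≠ 0` the defect energy density is `-2|λ|` under RH** (part VI, extended to `x₀ < 0`
by evenness). [this work] -/
theorem isGLB_defectEnergySet_of_ne_of_riemannHypothesis (hRH : RiemannHypothesis) {x₀ : ℝ}
    (hx0 : x₀ ≠ 0) (lam : ℝ) : IsGLB (defectEnergySet lam x₀) (-(2 * |lam|)) := by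
  rcases hx0.lt_or_gt with h | h
  · have e : defectEnergySet lam x₀ = defectEnergySet lam (-x₀) := by
      simp only [defectEnergySet, siteQuadratic_neg_site]
    rw [e]
    exact isGLB_defectEnergySet_of_riemannHypothesis hRH (neg_pos.2 h) lam
  · exact isGLB_defectEnergySet_of_riemannHypothesis hRH h lam

/-- **Dichotomy for every `(λ, x₀)`**: RH holds iff the defect energy density is finite
(`BddBelow`); then it equals `2λ` at `x₀ = 0` and `-2|λ|` at `x₀ ≠ 0`, and it is `-∞` if RH
fails.  (`λ = 0`: Weil's criterion, imported; RH NOT claimed.) [this work] -/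
theorem riemannHypothesis_iff_bddBelow_defectEnergySet_all (lam x₀ : ℝ) :
    RiemannHypothesis ↔ BddBelow (defectEnergySet lam x₀) := by
  constructor
  · intro hRH
    by_cases hx0 : x₀ = 0
    · subst hx0
      exact ⟨_, (isGLB_defectEnergySet_site_zero_of_riemannHypothesis hRH lam).1⟩
    · exact ⟨_, (isGLB_defectEnergySet_of_ne_of_riemannHypothesis hRH hx0 lam).1⟩
  · intro h
    by_contra hRH
    exact not_bddBelow_defectEnergySet_of_not_riemannHypothesis hRH x₀ lam h

end Summit.RiemannHypothesis.RiemannHypothesis.Theorems.PfPersistenceCoefficientRigidity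

end
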